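import Summits.QuantumFields.YangMills.Theses.ConvexGribovBody

/-!
# `ConvexGribovBody.Assembly` — the assembly item of route `ConvexGribovBody`

Route `ConvexGribovBody` (sub-problem `YangMills` of summit `QuantumFields`) files, as its assembly
item `Assembly` (stmt-QuantumFields-8784), the implication chain

`BrascampLiebVacuum → CovarianceBound → PoincareToGap → ContinuumLegGivenGap → YangMills`.

This was *verbatim* the type of the route's deciding theorem
`Summit.QuantumFields.YangMills.Theses.ConvexGribovBody.closes` as planner-authored until
2026-08-16T18:49Z (sorry-free, kernel-checked with the route file). Its content is pure bookkeeping: for a compact simple `G` with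
its Borel σ-algebra, `ContinuumLegGivenGap` reduces `YangMills` to the volume-uniform weak-coupling
lattice gap for every faithful unitary `r`; `BrascampLiebVacuum` gives `C > 0, β₁`, `CovarianceBound`
gives `β₂`; for `β ≥ max (max β₁ β₂) 1` one takes the two volume thresholds and `D > 0`, bounds
`Dmax ≤ D` by `ciSup_le`, and feeds `PoincareToGap` with `κ = C · D` (using `0 ≤ dir f`).
This file closes the item by exactly that bookkeeping (inlined at the fullbuild repair of 2026-08-16,
after the route-choice edit of 18:49Z re-typed `closes` with `BrascampLiebVacuumSC` and
`NonSimplyConnectedLatticeGap`; the item `Assembly` itself is unchanged); it adds no mathematics of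
its own.

Sources: route-internal (the deciding theorem `closes`); Jaffe–Witten 2000 for the clauses packaged
in `YangMills`; Osterwalder–Seiler 1978 for the clustering shape.
Deliberately NOT here: any of the cruxes (`BrascampLiebVacuum`, `CovarianceBound`, `PoincareToGap`,
`ContinuumLegGivenGap`), the target `UniformLatticeGap` or the support `StrongCouplingShape` — they
stay open items of the route.
-/

namespace Summit.QuantumFields.YangMills.Theorems

/-- **`ConvexGribovBody.Assembly` holds** (assembly item stmt-QuantumFields-8784): the chain
`BrascampLiebVacuum → CovarianceBound → PoincareToGap → ContinuumLegGivenGap → YangMills`.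
Proof: the bookkeeping of the route's (pre-2026-08-16T18:49Z) deciding theorem, inlined — thresholds
`max (max β₁ β₂) 1`, `max S₀ S₀'`, constant `κ = C · D` (the current `ConvexGribovBody.closes` takes
`BrascampLiebVacuumSC` and `NonSimplyConnectedLatticeGap` instead and is no longer literally this type).
[folklore] -/
theorem convexGribovBody_assembly_proof :
    Summit.QuantumFields.YangMills.Theses.ConvexGribovBody.Assembly := by
  unfold Summit.QuantumFields.YangMills.Theses.ConvexGribovBody.Assembly
  -- (fullbuild repair 2026-08-16: the route-choice edit of 2026-08-16T18:49Z re-typed `closes` with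
  -- `BrascampLiebVacuumSC` + `NonSimplyConnectedLatticeGap`; the former one-line `exact closes` is
  -- replaced by its bookkeeping, verbatim up to the quantifier order of `BrascampLiebVacuum`.)
  intro h₁ h₂ h₃ h₅ G _ _ _ _ hG
  letI : MeasurableSpace G := borel G
  haveI : BorelSpace G := ⟨rfl⟩
  refine h₅ G hG fun r => ?_
  obtain ⟨C, hC, β₁, hBL⟩ := h₁ G hG r
  obtain ⟨β₂, hCB⟩ := h₂ G hG r
  refine ⟨max (max β₁ β₂) 1, fun β hβ => ?_⟩
  have hβ₁ : β₁ ≤ β := le_trans (le_trans (le_max_left _ _) (le_max_left _ _)) hβ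
  have hβ₂ : β₂ ≤ β := le_trans (le_trans (le_max_right _ _) (le_max_left _ _)) hβ
  have hβ0 : 0 < β := lt_of_lt_of_le one_pos (le_trans (le_max_right _ _) hβ)
  obtain ⟨S₀, hS₀⟩ := hBL β hβ₁
  obtain ⟨D, hD, S₀', hS₀'⟩ := hCB β hβ₂
  refine h₃ G hG r β hβ0 (C * D) (mul_pos hC hD) (max S₀ S₀') fun S hS => ?_
  intro μ fro slope dir f hf₁ hf₂ hf₃
  have hA := hS₀ S (le_trans (le_max_left _ _) hS) f hf₁ hf₂ hf₃
  have hB := hS₀' S (le_trans (le_max_right _ _) hS)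
  have hdir : 0 ≤ dir f := by
    refine Finset.sum_nonneg fun e _ => ?_
    split_ifs
    · exact MeasureTheory.integral_nonneg fun U => sq_nonneg _
    · exact le_rfl
  refine le_trans hA ?_
  exact mul_le_mul_of_nonneg_right (mul_le_mul_of_nonneg_left (ciSup_le fun p => hB p) hC.le) hdir

end Summit.QuantumFields.YangMills.Theorems
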